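import Mathlib
import Summits.Ventures.HodgeRepro2.CyclotomicSeven

/-!
# CyclotomicSevenTypes — `Gal(ℚ(ζ₇)/ℚ) ≅ (ℤ/7)^×` and the explicit CM type of `ℚ(ζ₇)`

Follow-up to `CyclotomicSeven.lean` (the concrete sextic Galois CM field `K7 = ℚ(ζ₇)`):

* `galEquivUnitsZMod : Gal(K7/ℚ) ≃* (ZMod 7)ˣ` (Mathlib's `IsCyclotomicExtension.autEquivPow`),
  `card_gal_K7 = 6`, and the INDEPENDENT route to cyclicity `isCyclic_gal_K7'` ((ℤ/7)ˣ is the unit group of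
  a finite field), agreeing with `GaloisSextic.isCyclic_gal_of_finrank_six` applied in `CyclotomicSeven`;
* the explicit purely imaginary element `delta7 = ζ₇ − ζ₇⁻¹` (`star_delta7`, `delta7_ne_zero`) and its CM type
  `cmTypeOfImaginary K7 delta7 = {τ | 0 < Im τ(ζ₇)}` — the three embeddings sending `ζ₇` into the upper half
  plane (`cmTypeOfImaginary_delta7`, `isCMType_upperHalf`, `ncard_upperHalf = 3`), and the rank-four face
  built on it (`exists_isWeilFace_upperHalf`).

Not formalised: the identification of the three members with `ζ₇ ↦ e^{2πik/7}`, `k = 1, 2, 3`.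
-/

namespace Summit.Ventures.HodgeRepro2.CyclotomicSeven

section Galois

/-- `Gal(K7/ℚ) ≅ (ℤ/7)^×`: Mathlib's `IsCyclotomicExtension.autEquivPow`. -/
noncomputable def galEquivUnitsZMod : (K7 ≃ₐ[ℚ] K7) ≃* (ZMod 7)ˣ :=
  IsCyclotomicExtension.autEquivPow K7 (Polynomial.cyclotomic.irreducible_rat (by norm_num : 0 < 7))

/-- `|Gal(K7/ℚ)| = φ(7) = 6`. -/
theorem card_gal_K7 : Nat.card (K7 ≃ₐ[ℚ] K7) = 6 := by
  rw [Nat.card_congr galEquivUnitsZMod.toEquiv, Nat.card_eq_fintype_card, ZMod.card_units_eq_totient]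
  decide

/-- `Gal(K7/ℚ)` is cyclic — the independent route: `(ℤ/7)^×` is the unit group of a finite field. -/
theorem isCyclic_gal_K7' : IsCyclic (K7 ≃ₐ[ℚ] K7) := by
  haveI : Fact (Nat.Prime 7) := ⟨by norm_num⟩
  exact isCyclic_of_surjective galEquivUnitsZMod.symm.toMonoidHom galEquivUnitsZMod.symm.surjective

end Galois

section CMType

/-- A primitive seventh root of unity in `K7`. -/
noncomputable def zeta7 : K7 := IsCyclotomicExtension.zeta 7 ℚ K7

/-- `zeta7` is a primitive seventh root of unity. -/
theorem isPrimitiveRoot_zeta7 : IsPrimitiveRoot zeta7 7 :=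
  IsCyclotomicExtension.zeta_spec 7 ℚ K7

/-- Every complex embedding sends `zeta7` to the unit circle. -/
theorem norm_emb_zeta7 (τ : K7 →+* ℂ) : ‖τ zeta7‖ = 1 :=
  Complex.norm_eq_one_of_pow_eq_one
    (by rw [← map_pow, isPrimitiveRoot_zeta7.pow_eq_one, map_one]) (by norm_num)

/-- Complex conjugation (the `star` of the CM field) inverts `zeta7`. -/
theorem star_zeta7 : star zeta7 = zeta7⁻¹ := by
  have h0 : star zeta7 = NumberField.IsCMField.complexConj K7 zeta7 := rfl
  obtain ⟨φ⟩ : Nonempty (K7 →+* ℂ) := inferInstance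
  apply φ.injective
  rw [h0, NumberField.IsCMField.complexEmbedding_complexConj, map_inv₀,
    Complex.inv_eq_conj (norm_emb_zeta7 φ)]

/-- The purely imaginary element `δ = ζ₇ − ζ₇⁻¹`. -/
noncomputable def delta7 : K7 := zeta7 - zeta7⁻¹

/-- `δ` is purely imaginary: `δ^ρ = −δ`. -/
theorem star_delta7 : star delta7 = -delta7 := by
  rw [delta7, star_sub, star_inv₀, star_zeta7, inv_inv, neg_sub]

/-- `δ ≠ 0` (a primitive seventh root of unity is not its own inverse). -/
theorem delta7_ne_zero : delta7 ≠ 0 := by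
  rw [delta7, sub_ne_zero]
  intro h
  have h2 : zeta7 ^ 2 = 1 := by
    rw [pow_two]
    nth_rewrite 2 [h]
    exact mul_inv_cancel₀ (isPrimitiveRoot_zeta7.ne_zero (by norm_num))
  have := (isPrimitiveRoot_zeta7.pow_eq_one_iff_dvd 2).1 h2
  omega

/-- The CM type of `δ` is the set of embeddings sending `ζ₇` into the upper half plane. -/
theorem cmTypeOfImaginary_delta7 :
    cmTypeOfImaginary K7 delta7 = {τ | 0 < (τ zeta7).im} := by
  ext τ
  simp only [cmTypeOfImaginary, Set.mem_setOf_eq, delta7, map_sub, map_inv₀]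
  rw [Complex.inv_eq_conj (norm_emb_zeta7 τ), Complex.sub_conj]
  simp only [Complex.mul_re, Complex.mul_im, Complex.neg_re, Complex.I_re, Complex.neg_im,
    Complex.I_im, Complex.ofReal_re, Complex.ofReal_im]
  constructor <;> intro h <;> linarith

/-- The embeddings sending `ζ₇` into the upper half plane form a CM type of `K7`. -/
theorem isCMType_upperHalf : IsCMType K7 {τ | 0 < (τ zeta7).im} :=
  cmTypeOfImaginary_delta7 ▸ isCMType_cmTypeOfImaginary K7 star_delta7 delta7_ne_zero

/-- Exactly three embeddings send `ζ₇` into the upper half plane. -/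
theorem ncard_upperHalf : ({τ | 0 < (τ zeta7).im} : Set (K7 →+* ℂ)).ncard = 3 :=
  ncard_cmType_eq_three K7 finrank_K7 isCMType_upperHalf

/-- The upper-half-plane CM type, indexed by `Fin 3`. -/
theorem exists_triple_upperHalf :
    ∃ τ : Fin 3 → (K7 →+* ℂ), Function.Injective τ ∧ Set.range τ = {τ | 0 < (τ zeta7).im} := by
  obtain ⟨x, y, z, hxy, hxz, hyz, hΦeq⟩ := Set.ncard_eq_three.1 ncard_upperHalf
  refine ⟨![x, y, z], ?_, ?_⟩
  · intro i j hij
    fin_cases i <;> fin_cases j <;> simp_all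
  · rw [hΦeq]
    ext w
    simp only [Matrix.range_cons, Matrix.range_empty, Set.union_empty, Set.singleton_union,
      Set.mem_insert_iff, Set.mem_singleton_iff]

/-- The rank-four face of `ℚ(ζ₇)` built on the upper-half-plane CM type (the objects of (S4), explicitly). -/
theorem exists_isWeilFace_upperHalf :
    ∃ τ : Fin 3 → (K7 →+* ℂ), Set.range τ = {τ | 0 < (τ zeta7).im} ∧
      IsWeilFace K7 (parityTetrahedron K7 τ) := by
  obtain ⟨τ, hinj, hrange⟩ := exists_triple_upperHalf
  exact ⟨τ, hrange, isWeilFace_parityTetrahedron K7 τ hinj (hrange ▸ isCMType_upperHalf)⟩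

end CMType

section Instantiation

/-- Shimura-1979 Theorem 8.1 data with `m = 3` exist over `ℚ(ζ₇)` for the upper-half-plane CM type and every
distinguished embedding in it (`Existence.exists_thm81Data_cmType`). -/
theorem exists_thm81Data_upperHalf (τ₁ : K7 →+* ℂ) (h : 0 < (τ₁ zeta7).im) :
    ∃ D : Thm81Data K7 2, D.Φ = {τ | 0 < (τ zeta7).im} ∧ D.τ = τ₁ :=
  exists_thm81Data_cmType K7 _ isCMType_upperHalf τ₁ h

/-- Theorem 8.1 data exist for every vertex of the face of `ℚ(ζ₇)` built on the upper-half-plane CM type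
and every member of that vertex (`Existence.exists_thm81Data_of_isWeilFace`). -/
theorem exists_thm81Data_face_upperHalf :
    ∃ τ : Fin 3 → (K7 →+* ℂ), Set.range τ = {τ | 0 < (τ zeta7).im} ∧
      ∀ (i : Fin 4), ∀ τ₁ ∈ parityTetrahedron K7 τ i,
        ∃ D : Thm81Data K7 2, D.Φ = parityTetrahedron K7 τ i ∧ D.τ = τ₁ := by
  obtain ⟨τ, hrange, hface⟩ := exists_isWeilFace_upperHalf
  exact ⟨τ, hrange, exists_thm81Data_of_isWeilFace K7 _ hface⟩

/-- THE INSTANTIATED HYPOTHESIS over `ℚ(ζ₇)` (TIER3 §1(ii)–(iii), `Instance.FaceInstance`): if Shimura's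
Theorem 8.1 holds over `K7` with `m = 3`, the face built on the upper-half-plane CM type is a `FaceInstance`. -/
theorem faceInstance_upperHalf (hS : ShimuraThm81 K7 2) :
    ∃ τ : Fin 3 → (K7 →+* ℂ), Set.range τ = {τ | 0 < (τ zeta7).im} ∧
      FaceInstance K7 (parityTetrahedron K7 τ) := by
  obtain ⟨τ, hrange, hface⟩ := exists_isWeilFace_upperHalf
  exact ⟨τ, hrange, faceInstance_of_shimuraThm81 K7 _ hface hS⟩

end Instantiation

end Summit.Ventures.HodgeRepro2.CyclotomicSeven
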